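import Summits.QuantumFields.YangMills.Theorems.BalabanUVNodesN15KingModelMasslessScalingBound
import Summits.QuantumFields.YangMills.Theorems.BalabanUVNodesN15KingModelMassMonotonicity
import Summits.QuantumFields.YangMills.Theorems.BalabanUVNodesN15KingModelInfiniteVolumeField
import Mathlib.Topology.Order.MonotoneConvergence

/-!
# BalabanUVNodes ∕ N15 — THE KING-MODEL RUNG (PART Ϻ-x): THE MASSLESS BLOCK FIELD IN `d + 1 ≥ 3` DIMENSIONS — the monotone limit `S₂^{0}(z) = lim_{m↓0}S₂^{ℝ}_m(z) = sup_{m>0}S₂^{ℝ}_m(z)`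
# exists (parts Ϻ-m∕u: antitone in `m`, bounded by `3`), inherits `0 < S₂^{0} ≤ 3`, the power law `S₂^{0}(z) ≤ Γ((d−1)∕2)∕(4π^{(d+1)∕2}R₋(z)^{d−1})` (Coulomb `1∕4πR₋` in three
# dimensions), evenness and positive-semidefiniteness; hence the MASSLESS infinite-volume block field `μ⁰_∞` exists as a centred Gaussian probability measure with covariance `S₂^{0}(w − z)`,
# and all `n`-point functions of `μ_{∞,m}` converge to those of `μ⁰_∞` as `m ↓ 0` (Track A, DAG node N15 = NE2; FAN-OUT v1.1 §N15 s3 «KING-MODEL RUNG»; count-neutral)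

HONEST FRAMING.  Count-neutral (cell `pub-ymgap`, seat `pub-ymgap-dag-n15-e` g35; `--supports stmt-QuantumFields-27366 --as helper` = K3⁸).  King's `A = 0`, `g = 0` model
([King1986] C. King, Commun. Math. Phys. **102** (1986) 649–677).  Block-spin renormalisation drives the mass to zero (`m_k = L^{−k}m`), so the relevant fixed-point object is the
MASSLESS block field; in `d + 1 ≥ 3` it exists at infinite volume.  Typed here: `S₂^{ℝ}_m(z)` is antitone in `m` (part Ϻ-m) and `≤ 3` uniformly (part Ϻ-u), so ★★ `S₂^{0}(z) := sup_{m>0}S₂^{ℝ}_m(z)`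
is the limit `m ↓ 0` (`tendsto_kingS2Inf_nhdsGT_zero`); ★ `0 < S₂^{0} ≤ 3`, ★★ `S₂^{0}(z) ≤ Γ((d−1)∕2)∕(4π^{(d+1)∕2}R₋(z)^{d−1})` (`R₋(z) > 0`), `≤ 1∕(4πR₋(z))` for `d + 1 = 3`; `S₂^{0}` is even and
★★ positive-semidefinite (limits of parts Ϝ-m's forms); ★★★ the massless field `μ⁰_∞ := gaussianFieldOfKernel(S₂^{0}(w−z))` is a centred Gaussian probability measure with
`∫φ(z)φ(w)dμ⁰_∞ = S₂^{0}(w−z)`, its `n`-point functions are hafnians of `S₂^{0}`, and ★★★ `∫Π_iφ(z_i)dμ_{∞,m} → ∫Π_iφ(z_i)dμ⁰_∞` as `m ↓ 0` — the massless block field is the `m ↓ 0` limit of King's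
massive ones in the sense of all moments.  NOT Bałaban's objects; NOT a node discharge; nothing continuum-Yang–Mills ∕ `ℝ⁴` ∕ OS ∕ Clay.  0 `sorry`; 3 defs (`kingS2Inf0`, `kingKernel0`, `kingFieldInf0`).

WHAT THIS FILE PROVES (kernel).  §1 def `kingS2Inf0`, `antitone_kingS2Inf_Ioi`, `bddAbove_range_kingS2Inf`, ★★ **`tendsto_kingS2Inf_nhdsGT_zero`**, `kingS2Inf_le_kingS2Inf0`, ★ `kingS2Inf0_pos`, ★ `kingS2Inf0_le_three`,
★★ **`kingS2Inf0_le_massless`**, ★ `kingS2Inf0_le_inv_four_pi_mul`, `kingS2Inf0_neg`, ★★ **`kingS2Inf0_posSemidef`**.  §2 def `kingKernel0`, `kingKernel0_symm`, ★★ `isPosSemidefKernel_kingKernel0`, def `kingFieldInf0`,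
★ `isProbabilityMeasure_kingFieldInf0`, `integral_eval_kingFieldInf0`, ★★ **`integral_eval_mul_eval_kingFieldInf0`**, ★★ `integral_prod_eval_kingFieldInf0_eq_hafnian`, `tendsto_hafnian`,
★★★ **`tendsto_nPoint_mass_zero_kingFieldInf`**.

HONEST SCOPE.  King's free `K = |Ω| = ∞` block field, `d + 1 ≥ 3`; the massless field is built at infinite volume only (as the `m ↓ 0` limit of the massive infinite-volume fields), not as a
thermodynamic limit of massless torus fields (which need the zero mode removed).  N15 untouched; counts unmoved.
Locators (use): [King1986] Thm 2.1 (2.22)–(2.23) p.654, (4.5)–(4.8) pp.670–671.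
-/

noncomputable section

open scoped BigOperators Topology
open Filter MeasureTheory Set

namespace Summit.QuantumFields.YangMills.BalabanUVNodes.N15KingModelRung.InfiniteVolume

open Literature.MathematicalPhysics.QuantumFieldTheory (IsPosSemidefKernel covGram covGram_apply gaussianFieldOfKernel isProbabilityMeasure_gaussianFieldOfKernel
  integral_eval_gaussianFieldOfKernel)
open Literature.Combinatorics.Enumerative (hafnian perfectMatchings)
open Literature.Combinatorics.Enumerative.HafnianGeneratingFunction (subMat)
open Summit.QuantumFields.YangMills.BalabanUVNodes.N15KingModelRung.FreeField
open Summit.QuantumFields.YangMills.BalabanUVNodes.N15KingModelRung.OptimalDecay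
open Summit.QuantumFields.YangMills.BalabanUVNodes.N15KingModelRung.ProperTime

variable {d : ℕ}

/-! ## §1 The massless two-point function `S₂^{0} = sup_{m>0}S₂^{ℝ}_m = lim_{m↓0}S₂^{ℝ}_m` -/

/-- **The massless infinite-volume two-point function** of King's continuum block field in `d + 1 ≥ 3` dimensions: `S₂^{0}(z) := sup_{m²>0}S₂^{ℝ}_{m}(z)` (`= lim_{m↓0}`, below).
[cite: King1986, Thm 2.1 (2.22) p.654, (4.5) p.670] -/
def kingS2Inf0 (z : Fin (d + 1) → ℤ) : ℝ := ⨆ m : Set.Ioi (0 : ℝ), kingS2Inf (m : ℝ) z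

/-- `m² ↦ S₂^{ℝ}_m(z)` is antitone on `(0,∞)` (part Ϻ-m). [cite: King1986, Thm 2.1 (2.22) p.654] -/
theorem antitone_kingS2Inf_Ioi (z : Fin (d + 1) → ℤ) : Antitone fun m : Set.Ioi (0 : ℝ) => kingS2Inf (m : ℝ) z :=
  fun a _ hab => kingS2Inf_anti_mass a.2 hab z

/-- `{S₂^{ℝ}_m(z) : m² > 0}` is bounded above (by `3`, part Ϻ-u; `d ≥ 2`). [folklore] -/
theorem bddAbove_range_kingS2Inf (hd : 2 ≤ d) (z : Fin (d + 1) → ℤ) : BddAbove (Set.range fun m : Set.Ioi (0 : ℝ) => kingS2Inf (m : ℝ) z) :=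
  ⟨3, by rintro _ ⟨m, rfl⟩; exact kingS2Inf_le_three hd m.2 z⟩

/-- ★★ **THE MASSLESS LIMIT EXISTS**: `S₂^{ℝ}_m(z) → S₂^{0}(z)` as `m² ↓ 0` (`d ≥ 2`; monotone convergence). [cite: King1986, Thm 2.1 (2.22) p.654] -/
theorem tendsto_kingS2Inf_nhdsGT_zero (hd : 2 ≤ d) (z : Fin (d + 1) → ℤ) : Tendsto (fun m2 : ℝ => kingS2Inf m2 z) (𝓝[>] 0) (𝓝 (kingS2Inf0 z)) := by
  have h := tendsto_atBot_ciSup (antitone_kingS2Inf_Ioi z) (bddAbove_range_kingS2Inf hd z)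
  rw [← map_coe_Ioi_atBot (0 : ℝ), tendsto_map'_iff]
  exact h

/-- `S₂^{ℝ}_m(z) ≤ S₂^{0}(z)` for every `m² > 0` (`d ≥ 2`). [folklore] -/
theorem kingS2Inf_le_kingS2Inf0 (hd : 2 ≤ d) {m2 : ℝ} (hm : 0 < m2) (z : Fin (d + 1) → ℤ) : kingS2Inf m2 z ≤ kingS2Inf0 z :=
  le_ciSup (bddAbove_range_kingS2Inf hd z) ⟨m2, hm⟩

/-- ★ `S₂^{0}(z) > 0`. [folklore] -/
theorem kingS2Inf0_pos (hd : 2 ≤ d) (z : Fin (d + 1) → ℤ) : 0 < kingS2Inf0 z :=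
  (kingS2Inf_pos one_pos z).trans_le (kingS2Inf_le_kingS2Inf0 hd one_pos z)

/-- ★ `S₂^{0}(z) ≤ 3` (part Ϻ-u in the limit). [folklore] -/
theorem kingS2Inf0_le_three (hd : 2 ≤ d) (z : Fin (d + 1) → ℤ) : kingS2Inf0 z ≤ 3 := by
  haveI : Nonempty (Set.Ioi (0 : ℝ)) := ⟨⟨1, Set.mem_Ioi.mpr zero_lt_one⟩⟩
  exact ciSup_le fun m => kingS2Inf_le_three hd m.2 z

/-- ★★ **THE MASSLESS POWER LAW**: `S₂^{0}(z) ≤ Γ((d−1)∕2)∕(4π^{(d+1)∕2}R₋(z)^{d−1})` for separated blocks (`R₋(z) > 0`, `d ≥ 2`) — canonical scaling of the massless block field.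
[cite: King1986, Thm 2.1 (2.22) p.654, (4.5) p.670] -/
theorem kingS2Inf0_le_massless (hd : 2 ≤ d) {z : Fin (d + 1) → ℤ} (hgap : 0 < blockGap z) :
    kingS2Inf0 z ≤ Real.Gamma (((d : ℝ) - 1) / 2) / (4 * Real.pi ^ (((d : ℝ) + 1) / 2) * blockGap z ^ (d - 1)) := by
  haveI : Nonempty (Set.Ioi (0 : ℝ)) := ⟨⟨1, Set.mem_Ioi.mpr zero_lt_one⟩⟩
  exact ciSup_le fun m => kingS2Inf_le_massless hd m.2 hgap

/-- ★ Three dimensions: `S₂^{0}(z) ≤ 1∕(4πR₋(z))` (the Coulomb potential). [cite: King1986, Thm 2.1 (2.22) p.654] -/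
theorem kingS2Inf0_le_inv_four_pi_mul {z : Fin (2 + 1) → ℤ} (hgap : 0 < blockGap z) : kingS2Inf0 z ≤ (4 * Real.pi * blockGap z)⁻¹ := by
  haveI : Nonempty (Set.Ioi (0 : ℝ)) := ⟨⟨1, Set.mem_Ioi.mpr zero_lt_one⟩⟩
  exact ciSup_le fun m => kingS2Inf_le_inv_four_pi_mul m.2 hgap

/-- `S₂^{0}` is even. [folklore] -/
theorem kingS2Inf0_neg (z : Fin (d + 1) → ℤ) : kingS2Inf0 (-z) = kingS2Inf0 z := by
  unfold kingS2Inf0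
  exact iSup_congr fun m => kingS2Inf_neg _ _

/-- ★★ **`S₂^{0}` IS POSITIVE-SEMIDEFINITE**: `Σ_{z,z′∈s}c_zS₂^{0}(z′−z)c_{z′} ≥ 0` (limit of part Ϝ-m's forms; `d ≥ 2`). [cite: King1986, Thm 2.1 (2.22) p.654] -/
theorem kingS2Inf0_posSemidef (hd : 2 ≤ d) (s : Finset (Fin (d + 1) → ℤ)) (c : (Fin (d + 1) → ℤ) → ℝ) :
    0 ≤ ∑ z ∈ s, ∑ z' ∈ s, c z * kingS2Inf0 (z' - z) * c z' := by
  have ht : Tendsto (fun m2 : ℝ => ∑ z ∈ s, ∑ z' ∈ s, c z * kingS2Inf m2 (z' - z) * c z') (𝓝[>] 0) (𝓝 (∑ z ∈ s, ∑ z' ∈ s, c z * kingS2Inf0 (z' - z) * c z')) :=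
    tendsto_finsetSum _ fun z _ => tendsto_finsetSum _ fun z' _ => ((tendsto_kingS2Inf_nhdsGT_zero hd _).const_mul _).mul_const _
  exact ge_of_tendsto ht (eventually_nhdsWithin_of_forall fun m2 hm2 => kingS2Inf_posSemidef hm2 s c)

/-! ## §2 The massless infinite-volume block field `μ⁰_∞` -/

/-- The massless covariance kernel `K⁰(z,w) = S₂^{0}(w − z)`. [cite: King1986, Thm 2.1 (2.22) p.654] -/
def kingKernel0 (z w : Fin (d + 1) → ℤ) : ℝ := kingS2Inf0 (w - z)

/-- `K⁰` is symmetric. [folklore] -/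
theorem kingKernel0_symm (z w : Fin (d + 1) → ℤ) : kingKernel0 z w = kingKernel0 w z := by
  unfold kingKernel0
  rw [← kingS2Inf0_neg (w - z), neg_sub]

/-- ★★ **`K⁰` is a positive-semidefinite kernel on `ℤ^{d+1}`** (`d ≥ 2`). [cite: King1986, Thm 2.1 (2.22) p.654] -/
theorem isPosSemidefKernel_kingKernel0 (hd : 2 ≤ d) : IsPosSemidefKernel (kingKernel0 (d := d)) := by
  intro I
  refine Matrix.PosSemidef.of_dotProduct_mulVec_nonneg ?_ fun x => ?_
  · ext s t
    simp only [Matrix.conjTranspose_apply, covGram_apply, star_trivial]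
    exact kingKernel0_symm _ _
  · have h := kingS2Inf0_posSemidef hd I (fun z => if hz : z ∈ I then x ⟨z, hz⟩ else 0)
    rw [sum_sum_dite_eq I x (fun z z' => kingS2Inf0 (z' - z))] at h
    have e : star x ⬝ᵥ (covGram kingKernel0 I).mulVec x = ∑ s : I, ∑ t : I, x s * kingS2Inf0 ((t : Fin (d + 1) → ℤ) - (s : Fin (d + 1) → ℤ)) * x t := by
      simp only [star_trivial, dotProduct, Matrix.mulVec, covGram_apply, kingKernel0, Finset.mul_sum]
      refine Finset.sum_congr rfl fun s _ => Finset.sum_congr rfl fun t _ => ?_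
      ring
    rw [e]
    exact h

/-- ★★★ **THE MASSLESS INFINITE-VOLUME BLOCK FIELD `μ⁰_∞`** (`d + 1 ≥ 3`): the centred Gaussian probability measure on `ℝ^{ℤ^{d+1}}` with covariance `S₂^{0}(w − z)`.
[cite: King1986, Thm 2.1 (2.22) p.654, (4.5) p.670; Kallenberg2002, Lemma 13.1] -/
def kingFieldInf0 (d : ℕ) : Measure ((Fin (d + 1) → ℤ) → ℝ) := gaussianFieldOfKernel (kingKernel0 (d := d))

/-- ★ `μ⁰_∞` is a probability measure (`d ≥ 2`). [folklore] -/
theorem isProbabilityMeasure_kingFieldInf0 (hd : 2 ≤ d) : IsProbabilityMeasure (kingFieldInf0 d) :=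
  isProbabilityMeasure_gaussianFieldOfKernel (isPosSemidefKernel_kingKernel0 hd)

/-- `μ⁰_∞` is centred. [folklore] -/
theorem integral_eval_kingFieldInf0 (hd : 2 ≤ d) (z : Fin (d + 1) → ℤ) : ∫ ω, ω z ∂kingFieldInf0 d = 0 :=
  integral_eval_gaussianFieldOfKernel (isPosSemidefKernel_kingKernel0 hd) z

/-- ★★ **The covariance of `μ⁰_∞` is the massless two-point function**: `∫φ(z)φ(w)dμ⁰_∞ = S₂^{0}(w − z)`. [cite: King1986, Thm 2.1 (2.22) p.654] -/
theorem integral_eval_mul_eval_kingFieldInf0 (hd : 2 ≤ d) (z w : Fin (d + 1) → ℤ) : ∫ ω, ω z * ω w ∂kingFieldInf0 d = kingS2Inf0 (w - z) :=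
  integral_eval_mul_eval_gaussianFieldOfKernel (isPosSemidefKernel_kingKernel0 hd) z w

/-- ★★ All `n`-point functions of `μ⁰_∞` are hafnians of `S₂^{0}` (Wick). [folklore] -/
theorem integral_prod_eval_kingFieldInf0_eq_hafnian (hd : 2 ≤ d) {W : Type*} [DecidableEq W] [LinearOrder W] (z : W → Fin (d + 1) → ℤ) (S : Finset W) :
    ∫ ω, (∏ i ∈ S, ω (z i)) ∂kingFieldInf0 d = hafnian (subMat (Matrix.of fun u v : W => kingS2Inf0 (z v - z u)) S) :=
  integral_prod_eval_gaussianFieldOfKernel_eq_hafnian (isPosSemidefKernel_kingKernel0 hd) z S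

/-- The hafnian is continuous in the matrix entries (a polynomial). [folklore] -/
theorem tendsto_hafnian {X V : Type*} [Fintype V] [DecidableEq V] [LinearOrder V] {l : Filter X} {A : X → Matrix V V ℝ} {B : Matrix V V ℝ}
    (h : ∀ u v, Tendsto (fun x => A x u v) l (𝓝 (B u v))) : Tendsto (fun x => hafnian (A x)) l (𝓝 (hafnian B)) := by
  simp only [hafnian]
  exact tendsto_finsetSum _ fun τ _ => tendsto_finsetProd _ fun v _ => h v (τ v)

/-- ★★★ **THE MASSIVE FIELDS CONVERGE TO THE MASSLESS ONE IN THE SENSE OF ALL MOMENTS**: for every finite family of sites, `∫Π_{i∈S}φ(z_i)dμ_{∞,m} → ∫Π_{i∈S}φ(z_i)dμ⁰_∞` as `m² ↓ 0` (`d ≥ 2`).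
[cite: King1986, Thm 2.1 (2.22)–(2.23) p.654] -/
theorem tendsto_nPoint_mass_zero_kingFieldInf (hd : 2 ≤ d) {W : Type*} [DecidableEq W] [LinearOrder W] (z : W → Fin (d + 1) → ℤ) (S : Finset W) :
    Tendsto (fun m2 : ℝ => ∫ ω, (∏ i ∈ S, ω (z i)) ∂kingFieldInf m2) (𝓝[>] 0) (𝓝 (∫ ω, (∏ i ∈ S, ω (z i)) ∂kingFieldInf0 d)) := by
  have hev : (fun m2 : ℝ => hafnian (subMat (Matrix.of fun u v : W => kingS2Inf m2 (z v - z u)) S)) =ᶠ[𝓝[>] 0]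
      fun m2 : ℝ => ∫ ω, (∏ i ∈ S, ω (z i)) ∂kingFieldInf m2 :=
    eventually_nhdsWithin_of_forall fun m2 hm2 => (integral_prod_eval_kingFieldInf_eq_hafnian hm2 z S).symm
  rw [integral_prod_eval_kingFieldInf0_eq_hafnian hd z S]
  refine Tendsto.congr' hev (tendsto_hafnian fun u v => ?_)
  simp only [Matrix.submatrix_apply, Matrix.of_apply]
  exact tendsto_kingS2Inf_nhdsGT_zero hd _

/-- ★★ In particular the covariances converge: `∫φ(z)φ(w)dμ_{∞,m} → ∫φ(z)φ(w)dμ⁰_∞ = S₂^{0}(w − z)` as `m² ↓ 0`. [folklore] -/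
theorem tendsto_covariance_mass_zero_kingFieldInf (hd : 2 ≤ d) (z w : Fin (d + 1) → ℤ) :
    Tendsto (fun m2 : ℝ => ∫ ω, ω z * ω w ∂kingFieldInf m2) (𝓝[>] 0) (𝓝 (kingS2Inf0 (w - z))) := by
  have hev : (fun m2 : ℝ => kingS2Inf m2 (w - z)) =ᶠ[𝓝[>] 0] fun m2 : ℝ => ∫ ω, ω z * ω w ∂kingFieldInf m2 :=
    eventually_nhdsWithin_of_forall fun m2 hm2 => (integral_eval_mul_eval_kingFieldInf hm2 z w).symm
  exact Tendsto.congr' hev (tendsto_kingS2Inf_nhdsGT_zero hd _)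

end Summit.QuantumFields.YangMills.BalabanUVNodes.N15KingModelRung.InfiniteVolume
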